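import Summits.KontsevichZagierPeriods.KontsevichZagierPeriods.Theorems.SymplecticScissorsRealOnePeriodRelationsStubEllRealise

/-!
# `BetaLinearSector` (stmt-KontsevichZagierPeriods-3897), line `fermat-sector-transport`:
# stub `stub_fermatRealise`

RULE 2 ALONG THE FERMAT CHART.  For `N, r, s ≥ 1` the beta cell
`[c · τ^{r/N−1} (1−τ)^{s/N−1}]` on `(0,1)` and the (bounded) arc representation
`[c · N · (1−u)^{r−1} u^{s−1} Q(u)^{−(r+s)/N}]` on `(0,1)`, `Q(u) = (1−u)^N + u^N`, differ by an
element of `M₁ = closure (1a ∪ 1b ∪ 2 ∪ Green)`: push the latter forward along the rational chart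
`τ = φ(u) = (1−u)^N / Q(u)` (`ℚ`-semialgebraic, strictly decreasing on `[0,1]`, `φ(0) = 1`, `φ(1) = 0`,
`φ′(u) = −N u^{N−1}(1−u)^{N−1} / Q(u)²`) by Kontsevich–Zagier's rule (2) in dimension one
(`helper_cells_1`); since `1 − φ(u) = u^N / Q(u)`, the push-forward has the domain and, on it, the
integrand of the beta cell (the Jacobian identity `fermatJacobian`), whence rule (1b).

References: M. Kontsevich, D. Zagier, *Periods* (2001), §1.2; B. Gross, *On the periods of abelian
integrals and a formula of Chowla and Selberg* (1978), §1 (Rohrlich's appendix).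
-/

noncomputable section
open Set MeasureTheory Filter Topology
open Literature.NumberTheory.Transcendental Literature.ModelTheory.ExponentialFields
open Summit.KontsevichZagierPeriods.SymplecticScissors.RealOnePeriodRelationsNegative (M₁)

namespace Summit.KontsevichZagierPeriods.FermatIsogeny.BetaLinearSector

/-- `Q(u) = (1−u)^N + u^N` is positive on `[0,1]`. [folklore] -/
theorem fermatQ_pos_Icc (N : ℕ) {u : ℝ} (hu : u ∈ Icc (0 : ℝ) 1) : 0 < (1 - u) ^ N + u ^ N := by
  rcases eq_or_lt_of_le hu.1 with h | h
  · subst h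
    exact add_pos_of_pos_of_nonneg (by norm_num) (pow_nonneg le_rfl N)
  · exact add_pos_of_nonneg_of_pos (pow_nonneg (sub_nonneg.2 hu.2) N) (pow_pos h N)

/-- The Fermat chart `φ(u) = (1−u)^N / Q(u)` has derivative `−N u^{N−1}(1−u)^{N−1} / Q(u)²`
wherever `Q(u) ≠ 0` (`N ≥ 1`). [folklore] -/
theorem hasDerivAt_fermatChart {N : ℕ} (hN : 1 ≤ N) (u : ℝ) (hQ : (1 - u) ^ N + u ^ N ≠ 0) :
    HasDerivAt (fun u : ℝ => (1 - u) ^ N / ((1 - u) ^ N + u ^ N))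
      (-((N : ℝ) * (u ^ (N - 1) * (1 - u) ^ (N - 1)) / ((1 - u) ^ N + u ^ N) ^ 2)) u := by
  obtain ⟨M, rfl⟩ : ∃ M, N = M + 1 := ⟨N - 1, (Nat.sub_add_cancel hN).symm⟩
  have h1 : HasDerivAt (fun u : ℝ => (1 - u) ^ (M + 1))
      (((M + 1 : ℕ) : ℝ) * (1 - u) ^ (M + 1 - 1) * (-1)) u :=
    ((hasDerivAt_id' u).const_sub 1).fun_pow (M + 1)
  have h2 : HasDerivAt (fun u : ℝ => u ^ (M + 1)) (((M + 1 : ℕ) : ℝ) * u ^ (M + 1 - 1)) u :=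
    hasDerivAt_pow (M + 1) u
  refine (h1.div (h1.fun_add h2) hQ).congr_deriv ?_
  rw [← neg_div, div_left_inj' (pow_ne_zero 2 hQ)]
  simp only [Nat.add_sub_cancel]
  push_cast
  ring

/-- The Fermat chart maps `(0,1)` into `(0,1)`. [folklore] -/
theorem fermatChart_mem_Ioo (N : ℕ) {u : ℝ} (hu : u ∈ Ioo (0 : ℝ) 1) :
    (1 - u) ^ N / ((1 - u) ^ N + u ^ N) ∈ Ioo (0 : ℝ) 1 := by
  have ha : 0 < (1 - u) ^ N := pow_pos (sub_pos.2 hu.2) N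
  have hb : 0 < u ^ N := pow_pos hu.1 N
  exact ⟨div_pos ha (add_pos ha hb), (div_lt_one (add_pos ha hb)).2 (lt_add_of_pos_right _ hb)⟩

/-- `1 − φ(u) = u^N / Q(u)` for the Fermat chart `φ(u) = (1−u)^N / Q(u)`. [folklore] -/
theorem one_sub_fermatChart (N : ℕ) {u : ℝ} (hQ : (1 - u) ^ N + u ^ N ≠ 0) :
    1 - (1 - u) ^ N / ((1 - u) ^ N + u ^ N) = u ^ N / ((1 - u) ^ N + u ^ N) := by
  rw [eq_div_iff hQ, sub_mul, div_mul_cancel₀ _ hQ]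
  ring

/-- The Fermat chart is strictly decreasing on `[0,1]` (`N ≥ 1`). [folklore] -/
theorem strictAntiOn_fermatChart {N : ℕ} (hN : 1 ≤ N) :
    StrictAntiOn (fun u : ℝ => (1 - u) ^ N / ((1 - u) ^ N + u ^ N)) (Icc 0 1) := by
  refine strictAntiOn_of_deriv_neg (convex_Icc 0 1) (fun x hx => ?_) fun x hx => ?_
  · exact (hasDerivAt_fermatChart hN x (fermatQ_pos_Icc N hx).ne').continuousAt.continuousWithinAt
  · rw [interior_Icc] at hx
    rw [(hasDerivAt_fermatChart hN x (fermatQ_pos_Icc N (Ioo_subset_Icc_self hx)).ne').deriv]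
    have hNpos : (0 : ℝ) < N := by exact_mod_cast hN
    exact neg_neg_of_pos (div_pos (mul_pos hNpos (mul_pos (pow_pos hx.1 _) (pow_pos (sub_pos.2 hx.2) _)))
      (pow_pos (fermatQ_pos_Icc N (Ioo_subset_Icc_self hx)) 2))

/-- The Fermat chart maps `(0,1)` onto `(0,1)`: it is continuous on `[0,1]` with `φ(0) = 1`,
`φ(1) = 0` (intermediate value theorem). [folklore] -/
theorem exists_fermatChart_eq {N : ℕ} (hN : 1 ≤ N) {x : ℝ} (hx : x ∈ Ioo (0 : ℝ) 1) :
    ∃ u ∈ Ioo (0 : ℝ) 1, (1 - u) ^ N / ((1 - u) ^ N + u ^ N) = x := by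
  have hcont : ContinuousOn (fun u : ℝ => (1 - u) ^ N / ((1 - u) ^ N + u ^ N)) (Icc 0 1) :=
    fun u hu => (hasDerivAt_fermatChart hN u (fermatQ_pos_Icc N hu).ne').continuousAt.continuousWithinAt
  have h := intermediate_value_Ioo' zero_le_one hcont
  have hN' : N ≠ 0 := by omega
  have h0 : (1 - (0 : ℝ)) ^ N / ((1 - 0) ^ N + 0 ^ N) = 1 := by simp [zero_pow hN']
  have h1 : (1 - (1 : ℝ)) ^ N / ((1 - 1) ^ N + 1 ^ N) = 0 := by simp [zero_pow hN']
  rw [h0, h1] at h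
  exact h hx

/-- THE JACOBIAN IDENTITY of the Fermat chart: for positive `a, b, q` (read `a = 1 − u`, `b = u`,
`q = Q(u)`), `(a^N/q)^{r/N−1} · (b^N/q)^{s/N−1} · b^{N−1} a^{N−1} / q² = a^{r−1} b^{s−1} q^{−(r+s)/N}`
(exponent bookkeeping after `a = e^{α}`, `b = e^{β}`, `q = e^{γ}`). [folklore] -/
theorem fermatJacobian {N r s : ℕ} (hN : 1 ≤ N) (hr : 1 ≤ r) (hs : 1 ≤ s) {a b q : ℝ}
    (ha : 0 < a) (hb : 0 < b) (hq : 0 < q) :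
    (a ^ N / q) ^ ((r : ℝ) / N - 1) * (b ^ N / q) ^ ((s : ℝ) / N - 1) *
        (b ^ (N - 1) * a ^ (N - 1) / q ^ 2) =
      a ^ (r - 1) * b ^ (s - 1) * q ^ (-((r : ℝ) + s) / N) := by
  obtain ⟨α, rfl⟩ : ∃ α, Real.exp α = a := ⟨Real.log a, Real.exp_log ha⟩
  obtain ⟨β, rfl⟩ : ∃ β, Real.exp β = b := ⟨Real.log b, Real.exp_log hb⟩
  obtain ⟨γ, rfl⟩ : ∃ γ, Real.exp γ = q := ⟨Real.log q, Real.exp_log hq⟩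
  have hN0 : (N : ℝ) ≠ 0 := by exact_mod_cast (by omega : N ≠ 0)
  simp only [← Real.exp_nat_mul, ← Real.exp_mul, ← Real.exp_sub, ← Real.exp_add]
  rw [Real.exp_eq_exp]
  push_cast [Nat.cast_sub hN, Nat.cast_sub hr, Nat.cast_sub hs]
  field_simp
  ring

/-- **Stub `stub_fermatRealise`** — RULE 2 ALONG `τ = (1−u)^N / Q(u)`: the beta cell
`[c·τ^{r/N−1}(1−τ)^{s/N−1}]` on `(0,1)` and the arc representation
`[c·N·(1−u)^{r−1}u^{s−1}Q(u)^{−(r+s)/N}]` on `(0,1)` differ by an element of `M₁` — the push-forward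
of the latter along the strictly decreasing rational chart `φ(u) = (1−u)^N/Q(u)`
(`φ′ = −N u^{N−1}(1−u)^{N−1}/Q²`, image `(0,1)`; `helper_cells_1`) has the domain and, on it, the
integrand of the former (`τ = φ(u)`, `1 − τ = u^N/Q(u)`), then rule 1b.
[cite: KontsevichZagier2001, §1.2 rule (2)] -/
theorem stub_fermatRealise : ∀ (N r s : ℕ) (c : ℝ), 1 ≤ N → 1 ≤ r → 1 ≤ s → IsAlgebraic ℚ c →
    ∀ (ρ R : KZ.IntegralRep 1), ρ.domain = {z | z 0 ∈ Set.Ioo (0:ℝ) 1} →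
    Set.EqOn ρ.integrand (fun z => c * (z 0) ^ ((r:ℝ) / N - 1) * (1 - z 0) ^ ((s:ℝ) / N - 1)) ρ.domain →
    R.domain = {z | z 0 ∈ Set.Ioo (0:ℝ) 1} →
    (∀ z ∈ R.domain, R.integrand z =
      c * N * ((1 - z 0) ^ (r - 1) * (z 0) ^ (s - 1) * ((1 - z 0) ^ N + (z 0) ^ N) ^ (-((r:ℝ) + s) / N))) →
    KZ.of ρ - KZ.of R ∈ M₁ := by
  intro N r s c hN hr hs _ ρ R hρ hρi hR hRi
  -- the chart and its derivative, as opaque functions with their defining equations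
  obtain ⟨φ, hφ⟩ : ∃ φ : ℝ → ℝ, ∀ u, φ u = (1 - u) ^ N / ((1 - u) ^ N + u ^ N) := ⟨_, fun _ => rfl⟩
  obtain ⟨φ', hφ'⟩ : ∃ φ' : ℝ → ℝ, ∀ u, φ' u =
      -((N : ℝ) * (u ^ (N - 1) * (1 - u) ^ (N - 1)) / ((1 - u) ^ N + u ^ N) ^ 2) := ⟨_, fun _ => rfl⟩
  have hφfun : φ = fun u => (1 - u) ^ N / ((1 - u) ^ N + u ^ N) := funext hφ
  have hmemR : ∀ p : Fin 1 → ℝ, p ∈ R.domain ↔ p 0 ∈ Ioo (0 : ℝ) 1 := fun p => by rw [hR]; rfl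
  have hmemρ : ∀ p : Fin 1 → ℝ, p ∈ ρ.domain ↔ p 0 ∈ Ioo (0 : ℝ) 1 := fun p => by rw [hρ]; rfl
  have hQpos : ∀ u ∈ Ioo (0 : ℝ) 1, 0 < (1 - u) ^ N + u ^ N := fun u hu =>
    fermatQ_pos_Icc N (Ioo_subset_Icc_self hu)
  have hJpos : ∀ u ∈ Ioo (0 : ℝ) 1,
      0 < (N : ℝ) * (u ^ (N - 1) * (1 - u) ^ (N - 1)) / ((1 - u) ^ N + u ^ N) ^ 2 := fun u hu =>
    div_pos (mul_pos (by exact_mod_cast hN) (mul_pos (pow_pos hu.1 _) (pow_pos (sub_pos.2 hu.2) _)))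
      (pow_pos (hQpos u hu) 2)
  have hneg : ∀ u ∈ Ioo (0 : ℝ) 1, φ' u < 0 := fun u hu => by
    rw [hφ']
    exact neg_neg_of_pos (hJpos u hu)
  -- semialgebraicity of the chart and of its derivative (rational functions over `ℚ`)
  have hσ := R.isSemialgebraic_domain
  have h0 : IsSemialgebraicFunOn ℚ R.domain (fun p : Fin 1 → ℝ => p 0) := isSemialgebraicFunOn_apply hσ 0
  have hc1 : IsSemialgebraicFunOn ℚ R.domain (fun _ => (1 : ℝ)) :=
    (isSemialgebraicFunOn_const_natCast hσ 1).congr fun _ _ => Nat.cast_one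
  have hcN : IsSemialgebraicFunOn ℚ R.domain (fun _ => (N : ℝ)) := isSemialgebraicFunOn_const_natCast hσ N
  have ha : IsSemialgebraicFunOn ℚ R.domain (fun p => 1 - p 0) := hc1.fun_sub h0
  have hQ : IsSemialgebraicFunOn ℚ R.domain (fun p => (1 - p 0) ^ N + (p 0) ^ N) :=
    (ha.fun_pow N).fun_add (h0.fun_pow N)
  have hQne : ∀ p ∈ R.domain, (1 - p 0) ^ N + (p 0) ^ N ≠ 0 := fun p hp =>
    (hQpos _ ((hmemR p).1 hp)).ne'
  have hφs : IsSemialgebraicFunOn ℚ R.domain (fun p => φ (p 0)) :=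
    ((ha.fun_pow N).div hQ hQne).congr fun p _ => (hφ (p 0)).symm
  have hφ's : IsSemialgebraicFunOn ℚ R.domain (fun p => φ' (p 0)) :=
    (((hcN.fun_mul ((h0.fun_pow (N - 1)).fun_mul (ha.fun_pow (N - 1)))).div (hQ.fun_pow 2)
      fun p hp => pow_ne_zero 2 (hQne p hp)).fun_neg).congr fun p _ => (hφ' (p 0)).symm
  -- calculus of the chart
  have hder : ∀ u ∈ Ioo (0 : ℝ) 1, HasDerivAt φ (φ' u) u := fun u hu => by
    rw [hφfun, hφ']
    exact hasDerivAt_fermatChart hN u (hQpos u hu).ne'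
  have hanti : StrictAntiOn φ (Icc 0 1) := by
    rw [hφfun]
    exact strictAntiOn_fermatChart hN
  have hmaps : ∀ u ∈ Ioo (0 : ℝ) 1, φ u ∈ Ioo (0 : ℝ) 1 := fun u hu => by
    rw [hφ]
    exact fermatChart_mem_Ioo N hu
  have hsurj : ∀ x ∈ Ioo (0 : ℝ) 1, ∃ u ∈ Ioo (0 : ℝ) 1, φ u = x := fun x hx => by
    simp only [hφ]
    exact exists_fermatChart_eq hN hx
  have hinj : InjOn (fun p : Fin 1 → ℝ => fun _ : Fin 1 => φ (p 0)) R.domain := by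
    intro p hp p' hp' h
    have h0 : φ (p 0) = φ (p' 0) := congrFun h 0
    have : p 0 = p' 0 :=
      hanti.injOn (Ioo_subset_Icc_self ((hmemR p).1 hp)) (Ioo_subset_Icc_self ((hmemR p').1 hp')) h0
    rw [KZ.eq_const_apply_zero p, KZ.eq_const_apply_zero p', this]
  -- rule 2: push `R` forward along the chart
  obtain ⟨P, hPdom, hPi, hrel⟩ :=
    Summit.KontsevichZagierPeriods.SymplecticScissors.RealOnePeriodRelations.helper_cells_1 R φ φ' hφs
      hφ's (fun p hp => hder _ ((hmemR p).1 hp)) (fun p hp => (hneg _ ((hmemR p).1 hp)).ne) hinj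
  -- the push-forward has the domain of `ρ` …
  have hPρ : P.domain = ρ.domain := by
    rw [hPdom, hρ]
    ext z
    constructor
    · rintro ⟨p, hp, rfl⟩
      exact hmaps _ ((hmemR p).1 hp)
    · intro hz
      obtain ⟨u, hu, huz⟩ := hsurj _ hz
      refine ⟨fun _ => u, (hmemR _).2 hu, ?_⟩
      rw [KZ.eq_const_apply_zero z]
      funext
      exact huz
  -- … and, on it, the integrand of `ρ` (the Jacobian identity)
  have heq : EqOn ρ.integrand P.integrand ρ.domain := by
    intro p hp
    obtain ⟨u, hu, hup⟩ := hsurj _ ((hmemρ p).1 hp)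
    have h := hPi (fun _ => u) ((hmemR _).2 hu)
    have hRu : R.integrand (fun _ => u) = c * N * ((1 - u) ^ (r - 1) * u ^ (s - 1) *
        ((1 - u) ^ N + u ^ N) ^ (-((r : ℝ) + s) / N)) := hRi _ ((hmemR _).2 hu)
    have hρu : ρ.integrand p = c * (p 0) ^ ((r : ℝ) / N - 1) * (1 - p 0) ^ ((s : ℝ) / N - 1) := hρi hp
    have hp0 : p = fun _ => φ u := by rw [KZ.eq_const_apply_zero p, hup]
    rw [← hup] at hρu
    rw [hρu, hp0, h, hRu, eq_div_iff (abs_pos.2 (hneg u hu).ne).ne', hφ', abs_of_neg (neg_neg_of_pos (hJpos u hu)),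
      neg_neg, hφ, one_sub_fermatChart N (hQpos u hu).ne']
    have hJ := fermatJacobian hN hr hs (sub_pos.2 hu.2) hu.1 (hQpos u hu)
    calc c * ((1 - u) ^ N / ((1 - u) ^ N + u ^ N)) ^ ((r : ℝ) / N - 1) *
          (u ^ N / ((1 - u) ^ N + u ^ N)) ^ ((s : ℝ) / N - 1) *
          ((N : ℝ) * (u ^ (N - 1) * (1 - u) ^ (N - 1)) / ((1 - u) ^ N + u ^ N) ^ 2)
        = c * N * (((1 - u) ^ N / ((1 - u) ^ N + u ^ N)) ^ ((r : ℝ) / N - 1) *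
          (u ^ N / ((1 - u) ^ N + u ^ N)) ^ ((s : ℝ) / N - 1) *
          (u ^ (N - 1) * (1 - u) ^ (N - 1) / ((1 - u) ^ N + u ^ N) ^ 2)) := by ring
      _ = c * N * ((1 - u) ^ (r - 1) * u ^ (s - 1) * ((1 - u) ^ N + u ^ N) ^ (-((r : ℝ) + s) / N)) := by
          rw [hJ]
  have h2 : KZ.of ρ - KZ.of P ∈ M₁ :=
    Summit.KontsevichZagierPeriods.SymplecticScissors.RealOnePeriodRelations.HomotopyInvariance.of_sub_of_mem_of_eqOn
      ρ P hPρ heq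
  have e : KZ.of ρ - KZ.of R = (KZ.of ρ - KZ.of P) - (KZ.of R - KZ.of P) := by abel
  rw [e]
  exact M₁.sub_mem h2 hrel

end Summit.KontsevichZagierPeriods.FermatIsogeny.BetaLinearSector

end
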